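import Summits.ResolutionOfSingularities.ResolutionOfSingularities.Theorems.ProximityCutCorner
import HarnessLib

/-!
# ProximityCutOrigin — NO ORIGIN TAILS AT ALL: `NoOriginTails` PROVED IN LEAN (lens §6b, E-model half)
(lens-3 g12 node «ProximityCut» rev 3a (sha256 3a2d1668… = rev 3 e1d6297007058045 + lint fix :1743);
CRITIC-LEDGER rows 79 / 83 / 84 (CLEARED, CLEARED-REV, CLEARED-REV3))

[WRITER NOTE (decomp-res writer g5).  Lens `section Origin` (:1602–:1745) VERBATIM (`no_triply_thin`,
`lineage_eventually_fat3`, `no_origin_tail_rec`, the piece `NoOriginTails` with `noOriginTails_holds` / `_deep`,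
`noCornerHuggingTails_of_noOriginTails`); the three-letter integer dynamics `dyn3_eventually` it instantiates is the
landed-separately `CornerTowerDynamicsThree` (lens §6b `section Dyn3`; its module docstring there is the lens's §6b
header).  Critic row 84: [NECESSARY (31770 sub-piece) · STRICTLY WEAKER · DECIDED — PROVED port-free; `NoOriginTails`
⊋ `NoCornerHuggingTails` ⊋ `NoAxisTails`; = lens-5's pre-announced NoCornerTails on root walks, `q = p^e`]; every chart
change at the origin is a proximity repeat, so this is a decided piece INSIDE the residual `NoRecurrentProximity(Deep)`,
whose open content is now «tails through infinitely many TRANSLATED centres `b_t ≠ 0` with recurrent proximity»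
(lens-5 g14 takes the translation-recurrent residual).  0 sorry; Prop piece `NoOriginTails`.]
(Sources: Hauser2010 Lecture IX; BierstoneGrigorievMilmanWlodarczyk2011, §3.)
-/

open MvPolynomial
open Literature.AlgebraicGeometry.Resolution
open Literature.AlgebraicGeometry.Resolution.Hauser2010
open Literature.AlgebraicGeometry.Resolution.PointBlowup
open Summit.ResolutionOfSingularities.ResolutionOfSingularities.Theorems.TightDefectClasses
open Summit.ResolutionOfSingularities.ResolutionOfSingularities.Theorems.TightDefectStrongWalks
open Summit.ResolutionOfSingularities.ResolutionOfSingularities.Theorems.ItineraryCutClasses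
open Summit.ResolutionOfSingularities.ResolutionOfSingularities.Theorems.BoundaryLedger
open Summit.ResolutionOfSingularities.ResolutionOfSingularities.Theorems.CornerTowerDynamics

namespace Summit.ResolutionOfSingularities.ResolutionOfSingularities.Theorems.ProximityCut

section Origin

variable {K : Type} [Field K] [DecidableEq K] {q : ℕ} {s₀ : State (Fin 3) K}

/-- **(i₃) NO TRIPLY THIN MONOMIALS (PROVED).**  On an origin tail (any charts) no monomial of `F_t` (`t ≥ N`) is
thin off all three coordinates: its image is again triply thin, never a `q`-th power, of smaller degree. [folklore] -/
theorem no_triply_thin (hs : IsRoot q s₀) (W : ForcedWalk q s₀) {N : ℕ} (hN : ∀ t, N ≤ t → W.b t = 0) :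
    ∀ n t : ℕ, N ≤ t → ∀ d ∈ (W.st t).F.support, (∀ x, offDeg x d < q) → d.degree ≤ n → False := by
  classical
  have step : ∀ t, N ≤ t → ∀ d ∈ (W.st t).F.support, (∀ x, offDeg x d < q) →
      chartExponent q (W.j t) d ∈ (W.st (t + 1)).F.support ∧
        (∀ x, offDeg x (chartExponent q (W.j t) d) < q) ∧ (chartExponent q (W.j t) d).degree < d.degree := by
    intro t ht d hd hthin
    have hdeg : q ≤ d.degree := le_degree_of_mem_support hs W t hd
    have hndvd : ¬ IsPthPowerExponent q d := not_isPthPowerExponent_of_mem_support hs W t hd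
    have e1 : offDeg (W.j t) (chartExponent q (W.j t) d) = offDeg (W.j t) d := offDeg_chartExponent_self q _ d
    have e3 := degree_chartExponent_add q (W.j t) d hdeg
    have hthin' : ∀ x, offDeg x (chartExponent q (W.j t) d) < q := by
      intro x
      by_cases hx : x = W.j t
      · rw [hx, e1]; exact hthin _
      · have e2 := offDeg_chartExponent_of_ne q hx d hdeg
        have := hthin x
        have := hthin (W.j t)
        omega
    have hlt : (chartExponent q (W.j t) d).degree < d.degree := by have := hthin (W.j t); omega
    refine ⟨image_mem_support hs W t rfl (hN t ht) hd ?_, hthin', hlt⟩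
    refine not_isPthPowerExponent_of_lt (fun x => ?_) ?_
    · obtain ⟨x', hx'⟩ := exists_ne x
      exact lt_of_le_of_lt (apply_le_offDeg (Ne.symm hx') _) (hthin' x')
    · intro hc0
      have hα0 : Finsupp.erase (W.j t) d = 0 := by
        rw [← chartExponent_erase q (W.j t) d, hc0, Finsupp.erase_zero]
      have hsum := degree_erase_add d (W.j t)
      have hdeg0 : (chartExponent q (W.j t) d).degree = 0 := by rw [hc0, map_zero]
      have hαdeg : (Finsupp.erase (W.j t) d).degree = 0 := by rw [hα0, map_zero]
      have hja' : d (W.j t) = q := by unfold offDeg at e3; omega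
      refine hndvd ?_
      rw [eq_single_of_erase_eq_zero hα0, hja']
      exact (isPthPowerExponent_single_iff (by omega)).mpr (dvd_refl q)
  intro n
  induction n with
  | zero =>
    intro t ht d hd hthin hn
    have := le_degree_of_mem_support hs W t hd
    have := hthin 0
    have h0 := degree_erase_add d 0
    unfold offDeg at *
    omega
  | succ n ih =>
    intro t ht d hd hthin hn
    obtain ⟨hmem, g1, glt⟩ := step t ht d hd hthin
    exact ih (t + 1) (by omega) _ hmem g1 (by omega)

/-- **(ii₃) LINEAGE FATTENING IN EVERY DIRECTION (PROVED)** on an origin tail with all three charts recurring: the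
three-letter dynamics of `(y_0, y_1, y_2)`, fed by `no_triply_thin`. [folklore] -/
theorem lineage_eventually_fat3 (hs : IsRoot q s₀) (W : ForcedWalk q s₀) {N : ℕ} (hN : ∀ t, N ≤ t → W.b t = 0)
    (hrec : ∀ (x : Fin 3) (n : ℕ), ∃ m, n ≤ m ∧ W.j (N + m) = x) {d₀ : Fin 3 →₀ ℕ}
    (halive : ∀ n, desc W N d₀ n ∈ (W.st (N + n)).F.support) :
    ∃ n₀, ∀ n, n₀ ≤ n → ∀ x, q ≤ offDeg x (desc W N d₀ n) := by
  classical
  let yv : ℕ → Fin 3 → ℤ := fun n x => (offDeg x (desc W N d₀ n) : ℤ) - q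
  have hdeg : ∀ n, q ≤ (desc W N d₀ n).degree := fun n => le_degree_of_mem_support hs W (N + n) (halive n)
  have hstep : ∀ n x, yv (n + 1) x =
      if x = W.j (N + n) then yv n x else yv n x + yv n (W.j (N + n)) := by
    intro n x
    have hd : desc W N d₀ (n + 1) = chartExponent q (W.j (N + n)) (desc W N d₀ n) := rfl
    split_ifs with hx
    · simp only [yv, hd, hx, offDeg_chartExponent_self]
    · have e := offDeg_chartExponent_of_ne q hx (desc W N d₀ n) (hdeg n)
      simp only [yv, hd]
      omega
  have halive' : ∀ n, ∃ x, 0 ≤ yv n x := by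
    intro n
    by_contra h
    push Not at h
    exact no_triply_thin hs W hN _ (N + n) (by omega) _ (halive n)
      (fun x => by have := h x; simp only [yv] at this; omega) le_rfl
  obtain ⟨n₀, hn₀⟩ := dyn3_eventually hstep halive' hrec
  refine ⟨n₀, fun n hn x => ?_⟩
  have := hn₀ n hn x
  simp only [yv] at this
  omega

/-- **(iii₃) THREE RECURRING CHARTS AT THE ORIGIN (PROVED)**: pigeonhole over the support of `F_N` + lineage
fattening ⇒ a stage fat off `0` ⇒ `false_of_fat`. [folklore] -/
theorem no_origin_tail_rec (hs : IsRoot q s₀) (W : ForcedWalk q s₀) {N : ℕ} (hN : ∀ t, N ≤ t → W.b t = 0)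
    (hrec : ∀ (x : Fin 3) (n : ℕ), ∃ m, n ≤ m ∧ W.j (N + m) = x) : False := by
  classical
  let S := (W.st N).F.support
  let bad : (Fin 3 →₀ ℕ) → ℕ → Prop := fun d₀ n =>
    (∀ m, m ≤ n → desc W N d₀ m ∈ (W.st (N + m)).F.support) ∧ offDeg 0 (desc W N d₀ n) < q
  have hev : ∀ d₀ ∈ S, ∀ᶠ n in Filter.atTop, ¬ bad d₀ n := by
    intro d₀ _
    rw [Filter.eventually_atTop]
    by_cases halive : ∀ n, desc W N d₀ n ∈ (W.st (N + n)).F.support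
    · obtain ⟨n₀, hn₀⟩ := lineage_eventually_fat3 hs W hN hrec halive
      exact ⟨n₀, fun n hn hb => absurd (hn₀ n hn 0) (not_le.mpr hb.2)⟩
    · push Not at halive
      obtain ⟨n₁, hn₁⟩ := halive
      exact ⟨n₁, fun n hn hb => hn₁ (hb.1 n₁ hn)⟩
  obtain ⟨T, hT⟩ := Filter.eventually_atTop.mp ((Filter.eventually_all_finset S).mpr hev)
  refine false_of_fat W (N + T) 0 fun d hd => ?_
  obtain ⟨d₀, hd₀, hdesc, halive⟩ := exists_ancestor W hN T d hd
  have hnb := hT T le_rfl d₀ hd₀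
  by_contra hlt
  push Not at hlt
  exact hnb ⟨halive, by rw [hdesc]; exact hlt⟩

/-- PIECE · NO ORIGIN TAILS · PROVED IN LEAN (`noOriginTails_holds`): no forced walk from a root sits at the origin
of its charts from some stage on (`b_t = 0` for all `t ≥ N`), whatever the charts.  Port-free, all `e ≥ 1`, no shade
hypothesis; strictly contains the corner-hugging law (§6) and the axis law (§4); a DECIDED PIECE INSIDE the
proximity residual (every chart change at the origin is a proximity repeat). -/
def NoOriginTails : Prop :=
  ∀ p : ℕ, p.Prime → ∀ e : ℕ, 1 ≤ e → ∀ (K : Type) [Field K] [CharP K p] [PerfectField K] [DecidableEq K]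
    (s₀ : State (Fin 3) K), IsRoot (p ^ e) s₀ → ∀ W : ForcedWalk (p ^ e) s₀,
    ∀ N : ℕ, (∀ t, N ≤ t → W.b t = 0) → False

/-- **NO ORIGIN TAILS, PROVED.**  Some chart eventually dead ⇒ §6; all three recur ⇒ `no_origin_tail_rec`. [folklore] -/
theorem noOriginTails_holds : NoOriginTails := by
  intro p hp e he K _ _ _ _ s₀ hs W N hN
  classical
  by_cases hdead : ∃ (N₁ : ℕ) (k : Fin 3), ∀ t, N₁ ≤ t → W.j t ≠ k
  · obtain ⟨N₁, k, hk⟩ := hdead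
    exact noCornerHuggingTails_holds p hp e he K s₀ hs W (max N N₁) k fun t ht =>
      ⟨hN t (le_trans (le_max_left _ _) ht), hk t (le_trans (le_max_right _ _) ht)⟩
  · push Not at hdead
    refine no_origin_tail_rec hs W hN fun x n => ?_
    obtain ⟨t, ht, hjt⟩ := hdead (N + n) x
    exact ⟨t - N, by omega, by rw [show N + (t - N) = t by omega]; exact hjt⟩

/-- `NoOriginTails` on the deep defect column BY INSTANTIATION (a PROVED sub-piece of the blocker 31770 inside its
proximity residual). [folklore] -/
theorem noOriginTails_deep :
    ∀ p : ℕ, p.Prime → ∀ e : ℕ, 2 ≤ e → ∀ (K : Type) [Field K] [CharP K p] [PerfectField K] [DecidableEq K]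
    (s₀ : State (Fin 3) K), IsRoot (p ^ e) s₀ → ∀ W : ForcedWalk (p ^ e) s₀, (∀ i, 1 ≤ (W.st i).shade) →
    ∀ N : ℕ, (∀ t, N ≤ t → W.b t = 0) → False :=
  fun p hp e he K _ _ _ _ s₀ hs W _ N hN => noOriginTails_holds p hp e (by omega) K s₀ hs W N hN

/-- `NoOriginTails` implies the corner-hugging law (bookkeeping of the containments). [folklore] -/
theorem noCornerHuggingTails_of_noOriginTails (h : NoOriginTails) : NoCornerHuggingTails :=
  fun p hp e he K _ _ _ _ s₀ hs W N _k hN => h p hp e he K s₀ hs W N fun t ht => (hN t ht).1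

end Origin

end Summit.ResolutionOfSingularities.ResolutionOfSingularities.Theorems.ProximityCut
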